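import Literature.Barriers.CriticalPhenomena.PlaquetteWalkYBCurveIdentity
import HarnessLib

/-!
# Barrier catalogue (SAWScalingLimit): the complexified Yang–Baxter curve satisfies all fourteen
LOCAL forms of the necessity chain at EVERY admissible spin `t¹⁶ = −1`

Companion of `PlaquetteWalkSpinRigidity` (whose `rigidity_of_forms` derives the curve
`ybCurve ε t r` FROM the fourteen local forms — the group-one rows `gE, gN, gW, gS` and the
excursion rows `fA1, fA1', fB1, fB1', fC1, fC1', fE1, fE1'` (adjacent) and `fD2, fD2'` (opposite) —
read off fourteen kernel instances) and of `PlaquetteWalkYBCurveIdentity` (the identity itself at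
`σ = 5/8`). This file proves the CONVERSE at the local level, for every spin: for EVERY `t ≠ 0` and
every `r` with `r ≠ 0`, `t⁴ ≠ 1`, `t⁶(1 + r⁴) ≠ (1 + t¹²)r²`, the odd curve point `W = ybCurve (−1) t r`
with the odd coefficient vector `c = (1, r, −1, −r)` satisfies the TWELVE group-one and
adjacent-excursion forms IDENTICALLY (rational-function identities, `field_simp; ring` — the spin is
not used), and the two OPPOSITE-excursion forms `fD2, fD2'` exactly when moreover `t¹⁶ = −1`, through
the polynomial identities behind the tree's `t_pow_sixteen_of_forms`
(`t⁴(fD2 ± fD2') = t¹¹(fB1' ± fB1) ± (fA1' ± fA1) − v(c_N ± c_S)(t¹⁶ + 1)`). So at every admissible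
spin the fourteen local forms cut out EXACTLY the curve (`localForms_ybCurve`,
`PlaquetteWalkYBCurveLocalForms_holds`) — the local (necessary-condition) half of the venture lane's
conjecture C-B4 «the curve identity holds at all sixteen spins»; the global half (a generic
grouping result «local forms ⇒ relation for every outer root», typed in the tree only at `σ = 5/8`
inside `YangBaxterSAWGeneralDomain`) is not here. The even component (`ε = +1`, coefficients `(1, r, 1, r)`)
follows by the sign gauge and is not spelled out.

Sources: [cite: Glazman2015WeightedSAW, Lemma 3.1 and Appendix (the local linear system and its σ = ℓ/8 solutions)];
[cite: GlazmanManolescu2019, Lemma 2.1, eq. (7)].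

Status in print (venture lane «pcv-sawmu», label cell of record lit-2 g16, 2026-08-23: CONSOLIDATION AT
KERNEL RIGOUR on the unit circle; off the circle the status of `PlaquetteWalkYBCurveIdentity`): the local
system and its solution at every spin `σ = ℓ/8`, `ℓ` odd, are Glazman's
[cite: Glazman2015WeightedSAW, Lemma 3.1 (ECP 20 (2015) no. 86; proof p. 7: (3.11)–(3.14) and their conjugates, necessity «if (3.11)–(3.14) are not satisfied then (3.2) fails for some rhombi»; Appendix p. 12 «the solution is unique and given by (3.3)–(3.7)»)];
kernel-checked here for all sixteen spins `t¹⁶ = −1` and extended off the unit circle (complex `r`).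

Written for the venture lane «pcv-sawmu» (Tier B; b-engine-1 gen 10).
-/

noncomputable section

namespace Literature.Barriers.CriticalPhenomena.PlaquetteWalk

open Literature.Probability.RandomPlanarGeometry.SAW.YangBaxter Real Complex

section Forms

variable {t r : ℂ}

/-- `t⁴ − 1 ≠ 0`. [folklore] -/
private theorem t4_sub_one_ne_zero (ht4 : t ^ 4 ≠ 1) : t ^ 4 - 1 ≠ 0 :=
  fun h => ht4 (by linear_combination h)

/-- The curve's denominator in the form `field_simp` produces is nonzero. [folklore] -/
private theorem den_ne_zero' (hD : t ^ 6 * (1 + r ^ 4) - (1 + t ^ 12) * r ^ 2 ≠ 0) :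
    t ^ 6 * (1 + r ^ 4) - r ^ 2 * (1 + t ^ 12) ≠ 0 :=
  fun h => hD (by linear_combination h)

/-- The curve's triangular relation `R3` (odd component, `a = 1`, `b = r`):
`u₂ t² = u₁ − t(1 − v) r`. [cite: Glazman2015WeightedSAW, Lemma 3.1, Appendix (the triangular system)] -/
private theorem R3_ybCurve (ht : t ≠ 0) :
    (ybCurve (-1) t r).u₂ * t ^ 2 = (ybCurve (-1) t r).u₁ - t * (1 - (ybCurve (-1) t r).v) * r := by
  simp only [ybCurve, ybU2]
  field_simp
  ring

/-- The curve's triangular relation `R4` (odd component): `r u₁ (t⁴ − 1) = t(1 − v)(t² − r²)`.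
[cite: Glazman2015WeightedSAW, Lemma 3.1, Appendix (the triangular system)] -/
private theorem R4_ybCurve (ht4 : t ^ 4 ≠ 1) (hr : r ≠ 0) :
    r * (ybCurve (-1) t r).u₁ * (t ^ 4 - 1) = t * (1 - (ybCurve (-1) t r).v) * (t ^ 2 - r ^ 2) := by
  have ht4' := t4_sub_one_ne_zero ht4
  simp only [ybCurve, ybU1]
  field_simp
  ring

/-- Group-one form `gE` on the odd curve point (identically in `t`): `t²·gE = r·R3 − R4`.
[cite: Glazman2015WeightedSAW, Lemma 3.1, Appendix (the local linear system)] -/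
theorem gE_ybCurve (ht : t ≠ 0) (ht4 : t ^ 4 ≠ 1) (hr : r ≠ 0) :
    1 * t + (-1) * (ybCurve (-1) t r).v * t + (-r) * (ybCurve (-1) t r).u₁ * t ^ 2
    + r * (ybCurve (-1) t r).u₂ = 0 := by
  have R3 := R3_ybCurve (r := r) ht
  have R4 := R4_ybCurve ht4 hr
  have key : t ^ 2 * (1 * t + (-1) * (ybCurve (-1) t r).v * t + (-r) * (ybCurve (-1) t r).u₁ * t ^ 2
      + r * (ybCurve (-1) t r).u₂) = 0 := by
    linear_combination r * R3 - R4
  exact (mul_eq_zero.1 key).resolve_left (pow_ne_zero 2 ht)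

/-- Group-one form `gN` on the odd curve point (identically in `t`): `gN = R3`.
[cite: Glazman2015WeightedSAW, Lemma 3.1, Appendix (the local linear system)] -/
theorem gN_ybCurve (ht : t ≠ 0) :
    r * t + (-1) * (ybCurve (-1) t r).u₁ + 1 * (ybCurve (-1) t r).u₂ * t ^ 2
    + (-r) * (ybCurve (-1) t r).v * t = 0 := by
  linear_combination R3_ybCurve (r := r) ht

/-- Group-one form `gW` on the odd curve point (identically in `t`): `gW = −gE`.
[cite: Glazman2015WeightedSAW, Lemma 3.1, Appendix (the local linear system)] -/
theorem gW_ybCurve (ht : t ≠ 0) (ht4 : t ^ 4 ≠ 1) (hr : r ≠ 0) :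
    (-1) * t + 1 * (ybCurve (-1) t r).v * t + (-r) * (ybCurve (-1) t r).u₂
    + r * (ybCurve (-1) t r).u₁ * t ^ 2 = 0 := by
  linear_combination (-1) * gE_ybCurve ht ht4 hr

/-- Group-one form `gS` on the odd curve point (identically in `t`): `gS = −R3`.
[cite: Glazman2015WeightedSAW, Lemma 3.1, Appendix (the local linear system)] -/
theorem gS_ybCurve (ht : t ≠ 0) :
    (-r) * t + (-1) * (ybCurve (-1) t r).u₂ * t ^ 2 + 1 * (ybCurve (-1) t r).u₁
    + r * (ybCurve (-1) t r).v * t = 0 := by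
  linear_combination (-1) * R3_ybCurve (r := r) ht

/-- Adjacent-excursion form `fA1` on the odd curve point (identically in `t`). [cite: Glazman2015WeightedSAW, Lemma 3.1, Appendix (the local linear system)] -/
theorem fA1_ybCurve (ht4 : t ^ 4 ≠ 1) (hr : r ≠ 0)
    (hD : t ^ 6 * (1 + r ^ 4) - (1 + t ^ 12) * r ^ 2 ≠ 0) :
    (ybCurve (-1) t r).v * r + (ybCurve (-1) t r).u₂ * t ^ 5 * (-1)
    + (ybCurve (-1) t r).w₂ * t ^ 4 * (-r) = 0 := by
  have ht4' := t4_sub_one_ne_zero ht4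
  have hD' := den_ne_zero' hD
  simp only [ybCurve, ybU1, ybU2, ybV, ybW2]
  field_simp
  ring

/-- Adjacent-excursion form `fA1'` on the odd curve point (identically in `t`). [cite: Glazman2015WeightedSAW, Lemma 3.1, Appendix (the local linear system)] -/
theorem fA1p_ybCurve (ht4 : t ^ 4 ≠ 1) (hr : r ≠ 0)
    (hD : t ^ 6 * (1 + r ^ 4) - (1 + t ^ 12) * r ^ 2 ≠ 0) :
    (ybCurve (-1) t r).u₂ * t ^ 5 * 1 + (ybCurve (-1) t r).w₂ * t ^ 4 * r
    + (ybCurve (-1) t r).v * (-r) = 0 := by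
  have ht4' := t4_sub_one_ne_zero ht4
  have hD' := den_ne_zero' hD
  simp only [ybCurve, ybU1, ybU2, ybV, ybW2]
  field_simp
  ring

/-- Adjacent-excursion form `fB1` on the odd curve point (identically in `t`). [cite: Glazman2015WeightedSAW, Lemma 3.1, Appendix (the local linear system)] -/
theorem fB1_ybCurve (ht4 : t ^ 4 ≠ 1) (hr : r ≠ 0)
    (hD : t ^ 6 * (1 + r ^ 4) - (1 + t ^ 12) * r ^ 2 ≠ 0) :
    (ybCurve (-1) t r).w₁ * t * r + (ybCurve (-1) t r).u₁ * (-1)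
    + (ybCurve (-1) t r).v * t ^ 5 * (-r) = 0 := by
  have ht4' := t4_sub_one_ne_zero ht4
  have hD' := den_ne_zero' hD
  simp only [ybCurve, ybU1, ybV, ybW1]
  field_simp
  ring

/-- Adjacent-excursion form `fB1'` on the odd curve point (identically in `t`). [cite: Glazman2015WeightedSAW, Lemma 3.1, Appendix (the local linear system)] -/
theorem fB1p_ybCurve (ht4 : t ^ 4 ≠ 1) (hr : r ≠ 0)
    (hD : t ^ 6 * (1 + r ^ 4) - (1 + t ^ 12) * r ^ 2 ≠ 0) :
    (ybCurve (-1) t r).u₁ * 1 + (ybCurve (-1) t r).v * t ^ 5 * r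
    + (ybCurve (-1) t r).w₁ * t * (-r) = 0 := by
  have ht4' := t4_sub_one_ne_zero ht4
  have hD' := den_ne_zero' hD
  simp only [ybCurve, ybU1, ybV, ybW1]
  field_simp
  ring

/-- Adjacent-excursion form `fC1` on the odd curve point (identically in `t`). [cite: Glazman2015WeightedSAW, Lemma 3.1, Appendix (the local linear system)] -/
theorem fC1_ybCurve (ht : t ≠ 0) (ht4 : t ^ 4 ≠ 1) (hr : r ≠ 0)
    (hD : t ^ 6 * (1 + r ^ 4) - (1 + t ^ 12) * r ^ 2 ≠ 0) :
    (ybCurve (-1) t r).v * t ^ 5 * 1 + (ybCurve (-1) t r).w₂ * t * (-1)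
    + (ybCurve (-1) t r).u₂ * (-r) = 0 := by
  have ht4' := t4_sub_one_ne_zero ht4
  have hD' := den_ne_zero' hD
  simp only [ybCurve, ybU1, ybU2, ybV, ybW2]
  field_simp
  ring

/-- Adjacent-excursion form `fC1'` on the odd curve point (identically in `t`). [cite: Glazman2015WeightedSAW, Lemma 3.1, Appendix (the local linear system)] -/
theorem fC1p_ybCurve (ht : t ≠ 0) (ht4 : t ^ 4 ≠ 1) (hr : r ≠ 0)
    (hD : t ^ 6 * (1 + r ^ 4) - (1 + t ^ 12) * r ^ 2 ≠ 0) :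
    (ybCurve (-1) t r).w₂ * t * 1 + (ybCurve (-1) t r).u₂ * r
    + (ybCurve (-1) t r).v * t ^ 5 * (-1) = 0 := by
  have ht4' := t4_sub_one_ne_zero ht4
  have hD' := den_ne_zero' hD
  simp only [ybCurve, ybU1, ybU2, ybV, ybW2]
  field_simp
  ring

/-- Adjacent-excursion form `fE1` on the odd curve point (identically in `t`). [cite: Glazman2015WeightedSAW, Lemma 3.1, Appendix (the local linear system)] -/
theorem fE1_ybCurve (ht4 : t ^ 4 ≠ 1) (hr : r ≠ 0)
    (hD : t ^ 6 * (1 + r ^ 4) - (1 + t ^ 12) * r ^ 2 ≠ 0) :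
    (ybCurve (-1) t r).w₁ * t ^ 4 * 1 + (ybCurve (-1) t r).v * (-1)
    + (ybCurve (-1) t r).u₁ * t ^ 5 * (-r) = 0 := by
  have ht4' := t4_sub_one_ne_zero ht4
  have hD' := den_ne_zero' hD
  simp only [ybCurve, ybU1, ybV, ybW1]
  field_simp
  ring

/-- Adjacent-excursion form `fE1'` on the odd curve point (identically in `t`). [cite: Glazman2015WeightedSAW, Lemma 3.1, Appendix (the local linear system)] -/
theorem fE1p_ybCurve (ht4 : t ^ 4 ≠ 1) (hr : r ≠ 0)
    (hD : t ^ 6 * (1 + r ^ 4) - (1 + t ^ 12) * r ^ 2 ≠ 0) :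
    (ybCurve (-1) t r).v * 1 + (ybCurve (-1) t r).u₁ * t ^ 5 * r
    + (ybCurve (-1) t r).w₁ * t ^ 4 * (-1) = 0 := by
  have ht4' := t4_sub_one_ne_zero ht4
  have hD' := den_ne_zero' hD
  simp only [ybCurve, ybU1, ybV, ybW1]
  field_simp
  ring

/-- **Opposite-excursion forms `fD2, fD2'` on the odd curve point, at every admissible spin**
(`t¹⁶ = −1`): `t⁴(fD2 ± fD2') = t¹¹(fB1' ± fB1) ± (fA1' ± fA1) − v(c_N ± c_S)(t¹⁶ + 1)` identically
(the polynomial identities behind `t_pow_sixteen_of_forms`), and the right-hand sides vanish on the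
curve. [cite: Glazman2015WeightedSAW, Lemma 3.1 (proof: «either v = 0 or σ = ℓ/8»)] -/
theorem fD2_ybCurve (ht : t ≠ 0) (ht4 : t ^ 4 ≠ 1) (hr : r ≠ 0)
    (hD : t ^ 6 * (1 + r ^ 4) - (1 + t ^ 12) * r ^ 2 ≠ 0) (h16 : t ^ 16 = -1) :
    ((ybCurve (-1) t r).u₁ * t ^ 7 * 1 + (ybCurve (-1) t r).u₂ * t * (-1)
      + ((ybCurve (-1) t r).w₂ + (ybCurve (-1) t r).w₁ * t ^ 8) * (-r) = 0) ∧
    ((ybCurve (-1) t r).u₂ * t * 1 + ((ybCurve (-1) t r).w₂ + (ybCurve (-1) t r).w₁ * t ^ 8) * r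
      + (ybCurve (-1) t r).u₁ * t ^ 7 * (-1) = 0) := by
  have hA1 := fA1_ybCurve ht4 hr hD
  have hA1' := fA1p_ybCurve ht4 hr hD
  have hB1 := fB1_ybCurve ht4 hr hD
  have hB1' := fB1p_ybCurve ht4 hr hD
  set W := ybCurve (-1) t r with hW
  -- the even and odd combinations, times t⁴
  have hp : t ^ 4 * ((W.u₁ * t ^ 7 * 1 + W.u₂ * t * (-1) + (W.w₂ + W.w₁ * t ^ 8) * (-r)) +
      (W.u₂ * t * 1 + (W.w₂ + W.w₁ * t ^ 8) * r + W.u₁ * t ^ 7 * (-1))) = 0 := by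
    linear_combination t ^ 11 * (hB1' + hB1) + (hA1' + hA1) - (W.v * (r + (-r))) * h16
  have hm : t ^ 4 * ((W.u₁ * t ^ 7 * 1 + W.u₂ * t * (-1) + (W.w₂ + W.w₁ * t ^ 8) * (-r)) -
      (W.u₂ * t * 1 + (W.w₂ + W.w₁ * t ^ 8) * r + W.u₁ * t ^ 7 * (-1))) = 0 := by
    linear_combination t ^ 11 * (hB1' - hB1) - (hA1' - hA1) - (W.v * (r - (-r))) * h16
  have ht4ne : t ^ 4 ≠ 0 := pow_ne_zero 4 ht
  have hsum := (mul_eq_zero.1 hp).resolve_left ht4ne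
  have hdiff := (mul_eq_zero.1 hm).resolve_left ht4ne
  constructor
  · linear_combination (hsum + hdiff) / 2
  · linear_combination (hsum - hdiff) / 2

end Forms

/-- **The odd curve point satisfies all fourteen local forms of the necessity chain, at every
admissible spin** (`t¹⁶ = −1`; `r ≠ 0`, `t⁶(1+r⁴) ≠ (1+t¹²)r²`), with `c = oddCoeff r = (1, r, −1, −r)`:
the twelve hypotheses `gE, gN, gW, gS, fA1, …, fE1'` of `rigidity_of_forms` (these hold for EVERY
`t` with `t⁴ ≠ 1`) and the two opposite forms `fD2, fD2'`. [cite: Glazman2015WeightedSAW, Lemma 3.1 and Appendix] -/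
theorem localForms_ybCurve {t r : ℂ} (ht : t ≠ 0) (h16 : t ^ 16 = -1) (hr : r ≠ 0)
    (hD : t ^ 6 * (1 + r ^ 4) - (1 + t ^ 12) * r ^ 2 ≠ 0) :
    let W := ybCurve (-1) t r
    let c := oddCoeff r
    (c 0 * t + c 2 * W.v * t + c 3 * W.u₁ * t ^ 2 + c 1 * W.u₂ = 0) ∧
    (c 1 * t + c 2 * W.u₁ + c 0 * W.u₂ * t ^ 2 + c 3 * W.v * t = 0) ∧
    (c 2 * t + c 0 * W.v * t + c 3 * W.u₂ + c 1 * W.u₁ * t ^ 2 = 0) ∧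
    (c 3 * t + c 2 * W.u₂ * t ^ 2 + c 0 * W.u₁ + c 1 * W.v * t = 0) ∧
    (W.v * c 1 + W.u₂ * t ^ 5 * c 2 + W.w₂ * t ^ 4 * c 3 = 0) ∧
    (W.u₂ * t ^ 5 * c 0 + W.w₂ * t ^ 4 * c 1 + W.v * c 3 = 0) ∧
    (W.w₁ * t * c 1 + W.u₁ * c 2 + W.v * t ^ 5 * c 3 = 0) ∧
    (W.u₁ * c 0 + W.v * t ^ 5 * c 1 + W.w₁ * t * c 3 = 0) ∧
    (W.v * t ^ 5 * c 0 + W.w₂ * t * c 2 + W.u₂ * c 3 = 0) ∧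
    (W.w₂ * t * c 0 + W.u₂ * c 1 + W.v * t ^ 5 * c 2 = 0) ∧
    (W.w₁ * t ^ 4 * c 0 + W.v * c 2 + W.u₁ * t ^ 5 * c 3 = 0) ∧
    (W.v * c 0 + W.u₁ * t ^ 5 * c 1 + W.w₁ * t ^ 4 * c 2 = 0) ∧
    (W.u₁ * t ^ 7 * c 0 + W.u₂ * t * c 2 + (W.w₂ + W.w₁ * t ^ 8) * c 3 = 0) ∧
    (W.u₂ * t * c 0 + (W.w₂ + W.w₁ * t ^ 8) * c 1 + W.u₁ * t ^ 7 * c 2 = 0) := by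
  intro W c
  have ht4 : t ^ 4 ≠ 1 := by
    intro h4
    have : t ^ 16 = 1 := by
      calc t ^ 16 = (t ^ 4) ^ 4 := by ring
        _ = 1 := by rw [h4]; norm_num
    rw [h16] at this; norm_num at this
  have c0 : c 0 = 1 := rfl
  have c1 : c 1 = r := rfl
  have c2 : c 2 = -1 := rfl
  have c3 : c 3 = -r := rfl
  rw [c0, c1, c2, c3]
  obtain ⟨hD2, hD2'⟩ := fD2_ybCurve ht ht4 hr hD h16
  exact ⟨gE_ybCurve ht ht4 hr, gN_ybCurve ht, gW_ybCurve ht ht4 hr, gS_ybCurve ht,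
    fA1_ybCurve ht4 hr hD, fA1p_ybCurve ht4 hr hD, fB1_ybCurve ht4 hr hD, fB1p_ybCurve ht4 hr hD,
    fC1_ybCurve ht ht4 hr hD, fC1p_ybCurve ht ht4 hr hD, fE1_ybCurve ht4 hr hD, fE1p_ybCurve ht4 hr hD,
    hD2, hD2'⟩

/-- **Named statement `PlaquetteWalkYBCurveLocalForms`**: at every admissible spin (`t¹⁶ = −1`) the odd
points of the complexified Yang–Baxter curve satisfy the fourteen local forms of the necessity chain —
with `rigidity_of_forms` (tree): the local forms cut out EXACTLY the curve, spin by spin.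
[cite: Glazman2015WeightedSAW, Lemma 3.1 and Appendix] -/
def _root_.Literature.Barriers.CriticalPhenomena.PlaquetteWalkYBCurveLocalForms : Prop :=
  ∀ t r : ℂ, t ≠ 0 → t ^ 16 = -1 → r ≠ 0 → t ^ 6 * (1 + r ^ 4) - (1 + t ^ 12) * r ^ 2 ≠ 0 →
    let W := ybCurve (-1) t r
    let c := oddCoeff r
    (c 0 * t + c 2 * W.v * t + c 3 * W.u₁ * t ^ 2 + c 1 * W.u₂ = 0) ∧
    (c 1 * t + c 2 * W.u₁ + c 0 * W.u₂ * t ^ 2 + c 3 * W.v * t = 0) ∧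
    (c 2 * t + c 0 * W.v * t + c 3 * W.u₂ + c 1 * W.u₁ * t ^ 2 = 0) ∧
    (c 3 * t + c 2 * W.u₂ * t ^ 2 + c 0 * W.u₁ + c 1 * W.v * t = 0) ∧
    (W.v * c 1 + W.u₂ * t ^ 5 * c 2 + W.w₂ * t ^ 4 * c 3 = 0) ∧
    (W.u₂ * t ^ 5 * c 0 + W.w₂ * t ^ 4 * c 1 + W.v * c 3 = 0) ∧
    (W.w₁ * t * c 1 + W.u₁ * c 2 + W.v * t ^ 5 * c 3 = 0) ∧
    (W.u₁ * c 0 + W.v * t ^ 5 * c 1 + W.w₁ * t * c 3 = 0) ∧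
    (W.v * t ^ 5 * c 0 + W.w₂ * t * c 2 + W.u₂ * c 3 = 0) ∧
    (W.w₂ * t * c 0 + W.u₂ * c 1 + W.v * t ^ 5 * c 2 = 0) ∧
    (W.w₁ * t ^ 4 * c 0 + W.v * c 2 + W.u₁ * t ^ 5 * c 3 = 0) ∧
    (W.v * c 0 + W.u₁ * t ^ 5 * c 1 + W.w₁ * t ^ 4 * c 2 = 0) ∧
    (W.u₁ * t ^ 7 * c 0 + W.u₂ * t * c 2 + (W.w₂ + W.w₁ * t ^ 8) * c 3 = 0) ∧
    (W.u₂ * t * c 0 + (W.w₂ + W.w₁ * t ^ 8) * c 1 + W.u₁ * t ^ 7 * c 2 = 0)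

/-- **`PlaquetteWalkYBCurveLocalForms` holds.** [cite: Glazman2015WeightedSAW, Lemma 3.1 and Appendix] -/
theorem _root_.Literature.Barriers.CriticalPhenomena.PlaquetteWalkYBCurveLocalForms_holds :
    PlaquetteWalkYBCurveLocalForms :=
  fun _ _ ht h16 hr hD => localForms_ybCurve ht h16 hr hD

end Literature.Barriers.CriticalPhenomena.PlaquetteWalk
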